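import Summits.HodgeConjecture.CorCM.Census.CentralSquaresPairCorners

/-!
# The square-central class, XVIII: the corners of the DESIGNATED PAIR FACE at `m = 2` — star forms and `T₀`-defects

COR-CM (cell `pub-hodgecm2`), count-neutral kernel combinatorics by the binder seat b09 (gen 46; lane SQUARE-CENTRAL CLASS, part XVIII), on parts VI
(`thetaG_frame`), VII (`Y_sub_Y_mem`, `rep_unique'`), III (`rt_eq_self_of_transversal`), XVI (`tie_corner_dichotomy_shapeA`), XVII (`pair_corner_dichotomy_shapeA`),
II (`oflipCM_rt_self`, `dev_compl`) BY NAME.  Theorems only: no definition, no `decide`, no certificate, no named fact, no `sorry`.  HONEST FRAMING: `HC_CM` is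
NOT proved, here or anywhere in the tree; nothing here is a period or a headline.

THE FRAME `(T₀; T₁, Q)` of parts IV–VII at `m = 2`: base block `{T₀, T̄₀, T₁, T̄₁}`, `|T₀| = 8`, `𝓗 = T₀ ∖ T₁` of size `4`, swap `Q` (`T₀·Q⁻¹ = T₁`, `Q² = 1`,
place involution `σ` preserving `𝓗`), a base-change stable lattice `L ∋ pairs` fed by a strict lowering cover.  Notation `e₀ = [T₀]`, `e₁ = [T₁]`, `f_s = [T₀^{(s)}]`,
`g_s = [T₁^{(s)}]`, `P = pair`, `Y_s = (f_s − e₀) + (g_s − e₁)` (`s ∈ 𝓗`), `Rᶜ(T') = Σ_{T'} f + Σ_{(T₀∩T₁)∖T'} g − (m−1)(e₀ + e₁)` as in parts II/VII.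
At `m = 2` the designated pair face of the `Q`-stable level-4 type `{T | a, σa}` (part XIX) has the level-2 corner `⟨a, σa⟩` and two level-3 corners
`⟨p, a, σa⟩` (`p ∈ T ⊆ 𝓗`), all ties between `T₀` and `T̄₁`; the cover lowers each toward one of the two, uncontrolled (parts XVI/XVII).  This file prices
that ambiguity:

* §1 `thetaG_compl_frame` (the star form toward `T̄₁` in `T₀`-coordinates modulo pairs), `thetaG_sub_thetaG_compl_pair_mem` (level 2: the two star forms
  differ by `Rᶜ({a, σa})`), `thetaG_sub_thetaG_compl_tie_mem` (level 3: they differ by `Y_p + Rᶜ({a, σa})`), modulo pairs, `m = 2`.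
* §2 `defect_pair_corner_mem`, `defect_tie_corner_cases`: given `Rᶜ({a, σa}) ∈ L` (a second-swap relation, part XX), the `T₀`-defect
  `[X] − θ_{T₀}(typeSum [X])` of the level-2 corner lies in `L`, and that of a level-3 corner `⟨p, a, σa⟩` lies in `L` or in `−Y_p + L`.
* §3 `rt_pair_type_eq_self` (`{T | a, σa}·Q⁻¹ = {T | a, σa}`), `mapDomain_rt_Y` (`Y_p·Q⁻¹ = Y_{σp}`), `Y_sub_mapDomain_rt_Y_mem` (`Y_p − Y_p·Q⁻¹ ∈ L` for
  `p` in a transversal, part VII).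

## References
* [Pohlmann1968] H. Pohlmann, Algebraic cycles on abelian varieties of complex multiplication type, Ann. of Math. 88 (1968), Thm 1.
* [Milne1999] J. S. Milne, Lefschetz motives and the Tate conjecture, Compositio Math. 117 (1999), Prop. 2.1, p. 54.
-/


namespace Summit.HodgeConjecture.CorCM.Census.CentralSquares

open Finset
open scoped symmDiff
open Summit.HodgeConjecture.CorCM.Prior.AllgGroup.RfwfAllgGroup
open Summit.HodgeConjecture.CorCM.Census.BlockParity
open Summit.HodgeConjecture.CorCM.Census.Coinvariant
open Summit.HodgeConjecture.CorCM.Census.TwistGeneration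
open Summit.HodgeConjecture.CorCM.Census.BaseBlock
open Summit.HodgeConjecture.CorCM.Census.CoverClosure

noncomputable section

variable {G : Type*} [Group G] [Fintype G] [DecidableEq G] (c : G)

/-! ## §1 The two star forms of the corners of the designated face -/

/-- `T₀ ∖ T̄₁ = T₀ ∩ T₁` (central `c`). [folklore] -/
theorem sdiff_compl_eq_inter (hcen : ∀ x : G, x * c = c * x) (T₀ T₁ : CMF G c) : T₀.1 \ (rt c c T₁).1 = T₀.1 ∩ T₁.1 := by
  rw [dev_compl c hcen T₀ T₁]; ext x; simp only [mem_sdiff, mem_inter, not_and, not_not]; tauto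

/-- **The star form toward `T̄₁` in `T₀`-coordinates, modulo pairs.**  For every type `X`:
`θ_{T̄₁}(typeSum [X]) = Σ_{u ∈ D(X) ∖ (T₀∩T₁)} ((P(T₁^u) − g_u) − (P(T₁) − e₁)) + Σ_{u ∈ (T₀∩T₁) ∖ D(X)} ((P(T₁^u) − g_u) − (P(T₁) − e₁)) + (P(T₁) − e₁)`,
where `P = pair`, `g_u = [T₁^{(u)}]`, `e₁ = [T₁]`. [folklore] -/
theorem thetaG_compl_frame (hc2 : c * c = 1) (hcen : ∀ x : G, x * c = c * x) (T₀ T₁ X : CMF G c) :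
    thetaG c hc2 (rt c c T₁) (typeSum G c (Finsupp.single X 1)) =
      (∑ u ∈ (T₀.1 \ X.1) \ (T₀.1 ∩ T₁.1), ((pair c (oflipCM c hc2 u T₁) - Finsupp.single (oflipCM c hc2 u T₁) (1 : ℤ)) -
        (pair c T₁ - Finsupp.single T₁ 1))) +
      (∑ u ∈ (T₀.1 ∩ T₁.1) \ (T₀.1 \ X.1), ((pair c (oflipCM c hc2 u T₁) - Finsupp.single (oflipCM c hc2 u T₁) (1 : ℤ)) -
        (pair c T₁ - Finsupp.single T₁ 1))) +
      (pair c T₁ - Finsupp.single T₁ 1) := by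
  have hsr : ∀ Y : CMF G c, Finsupp.single (rt c c Y) (1 : ℤ) = pair c Y - Finsupp.single Y 1 := fun Y => by
    rw [pair, add_sub_cancel_left]
  rw [thetaG_frame c hc2 T₀ (rt c c T₁) X, sdiff_compl_eq_inter c hcen T₀ T₁]
  simp only [oflipCM_rt_self c hc2 hcen, hsr]

section Frame

variable (hc2 : c * c = 1) (hcen : ∀ x : G, x * c = c * x) (T₀ T₁ : CMF G c)
variable (hbase : ∀ Q : G, rt c Q T₀ = T₀ ∨ rt c Q T₀ = rt c c T₀ ∨ rt c Q T₀ = T₁ ∨ rt c Q T₀ = rt c c T₁)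
variable (m : ℕ) (hn : T₀.1.card = 4 * m) (hH : (T₀.1 \ T₁.1).card = 2 * m)
variable (Q : G) (hQ : rt c Q T₀ = T₁) (hQQ : Q * Q = 1)
variable (hσH : ∀ t ∈ T₀.1, ∀ t' ∈ T₀.1, (t' = t * Q ∨ t' = c * (t * Q)) → (t ∈ T₀.1 \ T₁.1 ↔ t' ∈ T₀.1 \ T₁.1))
variable (L : Submodule ℤ (CMF G c →₀ ℤ)) (hLrt : ∀ (Q' : G) (y : CMF G c →₀ ℤ), y ∈ L → Finsupp.mapDomain (rt c Q') y ∈ L)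
variable (hP : ∀ Ψ : CMF G c, pair c Ψ ∈ L)
variable (hcover : ∀ Ψ : CMF G c, 2 ≤ bpot c T₀ Ψ → ∃ Q₂ s s' : G, bpot c T₀ Ψ = ddist (rt c Q₂ T₀) Ψ ∧
    s ∈ (rt c Q₂ T₀).1 \ Ψ.1 ∧ s' ∈ (rt c Q₂ T₀).1 \ Ψ.1 ∧ s ≠ s' ∧
    gface c hc2 Ψ s s' ∈ L ∧
    ((∃ Q₁ t t' : G, bpot c T₀ Ψ = ddist (rt c Q₁ T₀) Ψ ∧ t ∈ (rt c Q₁ T₀).1 \ Ψ.1 ∧ t' ∈ (rt c Q₁ T₀).1 \ Ψ.1 ∧ t ≠ t' ∧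
        (∀ Q' : G, ddist (rt c Q' T₀) (oflipCM c hc2 t Ψ) = bpot c T₀ (oflipCM c hc2 t Ψ) → rt c Q' T₀ = rt c Q₁ T₀) ∧
        (∀ Q' : G, ddist (rt c Q' T₀) (oflipCM c hc2 t' Ψ) = bpot c T₀ (oflipCM c hc2 t' Ψ) → rt c Q' T₀ = rt c Q₁ T₀) ∧
        (∀ Q' : G, ddist (rt c Q' T₀) (oflipCM c hc2 t (oflipCM c hc2 t' Ψ)) = bpot c T₀ (oflipCM c hc2 t (oflipCM c hc2 t' Ψ)) →
          rt c Q' T₀ = rt c Q₁ T₀)) →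
      (∀ Q' : G, ddist (rt c Q' T₀) (oflipCM c hc2 s Ψ) = bpot c T₀ (oflipCM c hc2 s Ψ) → rt c Q' T₀ = rt c Q₂ T₀) ∧
      (∀ Q' : G, ddist (rt c Q' T₀) (oflipCM c hc2 s' Ψ) = bpot c T₀ (oflipCM c hc2 s' Ψ) → rt c Q' T₀ = rt c Q₂ T₀) ∧
      (∀ Q' : G, ddist (rt c Q' T₀) (oflipCM c hc2 s (oflipCM c hc2 s' Ψ)) = bpot c T₀ (oflipCM c hc2 s (oflipCM c hc2 s' Ψ)) →
        rt c Q' T₀ = rt c Q₂ T₀)))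

include hcen hn hH hP in
/-- **Level-2 corner: the two star forms differ by `Rᶜ({q, q'})`** (`m = 2`, pairs in `L`): for `D(Y) = {q, q'} ⊆ T₀ ∩ T₁`,
`θ_{T₀}(typeSum [Y]) − θ_{T̄₁}(typeSum [Y]) − Rᶜ({q, q'}) ∈ L`. [folklore] -/
theorem thetaG_sub_thetaG_compl_pair_mem (hm : m = 2) {q q' : G} (hq : q ∈ T₀.1 ∩ T₁.1) (hq' : q' ∈ T₀.1 ∩ T₁.1) (hqq' : q ≠ q')
    (Y : CMF G c) (hY : T₀.1 \ Y.1 = {q, q'}) :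
    thetaG c hc2 T₀ (typeSum G c (Finsupp.single Y 1)) - thetaG c hc2 (rt c c T₁) (typeSum G c (Finsupp.single Y 1)) -
      (∑ s ∈ ({q, q'} : Finset G), Finsupp.single (oflipCM c hc2 s T₀) (1 : ℤ) +
        ∑ u ∈ (T₀.1 ∩ T₁.1) \ {q, q'}, Finsupp.single (oflipCM c hc2 u T₁) (1 : ℤ) -
        ((m : ℤ) - 1) • (Finsupp.single T₀ (1 : ℤ) + Finsupp.single T₁ 1)) ∈ L := by
  subst hm
  have hHc : (T₀.1 ∩ T₁.1).card = 4 := by have h0 := card_sdiff_add_card_inter T₀.1 T₁.1; omega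
  have hsub : ({q, q'} : Finset G) ⊆ T₀.1 ∩ T₁.1 := by
    intro x hx; rw [mem_insert, mem_singleton] at hx; rcases hx with rfl | rfl
    · exact hq
    · exact hq'
  have h1 : (T₀.1 \ Y.1) \ (T₀.1 ∩ T₁.1) = ∅ := by rw [hY]; exact sdiff_eq_empty_iff_subset.mpr hsub
  have h2 : (T₀.1 ∩ T₁.1) \ (T₀.1 \ Y.1) = (T₀.1 ∩ T₁.1) \ {q, q'} := by rw [hY]
  have hU : (((T₀.1 ∩ T₁.1) \ {q, q'}).card : ℤ) = 2 := by
    have h : ((T₀.1 ∩ T₁.1) \ {q, q'}).card = 2 := by rw [card_sdiff_of_subset hsub, hHc, card_pair hqq']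
    exact_mod_cast h
  rw [thetaG_typeSum_single c T₀ hc2 Y, thetaG_compl_frame c hc2 hcen T₀ T₁ Y, h1, h2, hY, sum_empty, zero_add, sum_pair hqq', sum_pair hqq',
    sum_sub_distrib, sum_const, ← Nat.cast_smul_eq_nsmul ℤ, hU]
  have e : ((Finsupp.single (oflipCM c hc2 q T₀) (1 : ℤ) - Finsupp.single T₀ 1) + (Finsupp.single (oflipCM c hc2 q' T₀) (1 : ℤ) - Finsupp.single T₀ 1) +
      Finsupp.single T₀ 1) -
      (∑ u ∈ (T₀.1 ∩ T₁.1) \ {q, q'}, (pair c (oflipCM c hc2 u T₁) - Finsupp.single (oflipCM c hc2 u T₁) (1 : ℤ)) -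
        (2 : ℤ) • (pair c T₁ - Finsupp.single T₁ 1) + (pair c T₁ - Finsupp.single T₁ 1)) -
      (Finsupp.single (oflipCM c hc2 q T₀) (1 : ℤ) + Finsupp.single (oflipCM c hc2 q' T₀) 1 +
        ∑ u ∈ (T₀.1 ∩ T₁.1) \ {q, q'}, Finsupp.single (oflipCM c hc2 u T₁) (1 : ℤ) -
        (((2 : ℕ) : ℤ) - 1) • (Finsupp.single T₀ (1 : ℤ) + Finsupp.single T₁ 1)) =
      pair c T₁ - (∑ u ∈ (T₀.1 ∩ T₁.1) \ {q, q'}, (pair c (oflipCM c hc2 u T₁) - Finsupp.single (oflipCM c hc2 u T₁) (1 : ℤ)) +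
        ∑ u ∈ (T₀.1 ∩ T₁.1) \ {q, q'}, Finsupp.single (oflipCM c hc2 u T₁) (1 : ℤ)) := by
    push_cast; module
  rw [e, ← sum_add_distrib]
  refine Submodule.sub_mem _ (hP T₁) (Submodule.sum_mem _ fun u _ => ?_)
  rw [sub_add_cancel]; exact hP _

include hcen hn hH hP in
/-- **Level-3 corner: the two star forms differ by `Y_p + Rᶜ({q, q'})`** (`m = 2`, pairs in `L`): for `D(X) = {p, q, q'}`, `p ∈ 𝓗`, `q ≠ q' ∈ T₀ ∩ T₁`,
`θ_{T₀}(typeSum [X]) − θ_{T̄₁}(typeSum [X]) − Y_p − Rᶜ({q, q'}) ∈ L`. [folklore] -/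
theorem thetaG_sub_thetaG_compl_tie_mem (hm : m = 2) {p q q' : G} (hp : p ∈ T₀.1 \ T₁.1) (hq : q ∈ T₀.1 ∩ T₁.1) (hq' : q' ∈ T₀.1 ∩ T₁.1)
    (hqq' : q ≠ q') (X : CMF G c) (hX : T₀.1 \ X.1 = {p, q, q'}) :
    thetaG c hc2 T₀ (typeSum G c (Finsupp.single X 1)) - thetaG c hc2 (rt c c T₁) (typeSum G c (Finsupp.single X 1)) -
      ((Finsupp.single (oflipCM c hc2 p T₀) (1 : ℤ) - Finsupp.single T₀ 1) + (Finsupp.single (oflipCM c hc2 p T₁) (1 : ℤ) - Finsupp.single T₁ 1)) -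
      (∑ s ∈ ({q, q'} : Finset G), Finsupp.single (oflipCM c hc2 s T₀) (1 : ℤ) +
        ∑ u ∈ (T₀.1 ∩ T₁.1) \ {q, q'}, Finsupp.single (oflipCM c hc2 u T₁) (1 : ℤ) -
        ((m : ℤ) - 1) • (Finsupp.single T₀ (1 : ℤ) + Finsupp.single T₁ 1)) ∈ L := by
  subst hm
  have hHc : (T₀.1 ∩ T₁.1).card = 4 := by have h0 := card_sdiff_add_card_inter T₀.1 T₁.1; omega
  have hsub : ({q, q'} : Finset G) ⊆ T₀.1 ∩ T₁.1 := by
    intro x hx; rw [mem_insert, mem_singleton] at hx; rcases hx with rfl | rfl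
    · exact hq
    · exact hq'
  have hpH : p ∉ T₀.1 ∩ T₁.1 := fun h => (mem_sdiff.mp hp).2 (mem_inter.mp h).2
  have hpqq : p ∉ ({q, q'} : Finset G) := fun h => hpH (hsub h)
  have h1 : (T₀.1 \ X.1) \ (T₀.1 ∩ T₁.1) = {p} := by
    rw [hX, insert_sdiff_of_notMem _ hpH, sdiff_eq_empty_iff_subset.mpr hsub]; exact LawfulSingleton.insert_empty_eq p
  have h2 : (T₀.1 ∩ T₁.1) \ (T₀.1 \ X.1) = (T₀.1 ∩ T₁.1) \ {q, q'} := by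
    rw [hX]
    ext x; simp only [mem_sdiff, mem_insert, mem_singleton, not_or]
    constructor
    · rintro ⟨hx, -, h⟩; exact ⟨hx, h⟩
    · rintro ⟨hx, h⟩; exact ⟨hx, fun e => hpH (e ▸ hx), h⟩
  have hU : (((T₀.1 ∩ T₁.1) \ {q, q'}).card : ℤ) = 2 := by
    have h : ((T₀.1 ∩ T₁.1) \ {q, q'}).card = 2 := by rw [card_sdiff_of_subset hsub, hHc, card_pair hqq']
    exact_mod_cast h
  rw [thetaG_typeSum_single c T₀ hc2 X, thetaG_compl_frame c hc2 hcen T₀ T₁ X, h1, h2, hX, sum_singleton, sum_insert hpqq, sum_pair hqq',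
    sum_pair hqq', sum_sub_distrib, sum_const, ← Nat.cast_smul_eq_nsmul ℤ, hU]
  have e : ((Finsupp.single (oflipCM c hc2 p T₀) (1 : ℤ) - Finsupp.single T₀ 1) +
      ((Finsupp.single (oflipCM c hc2 q T₀) (1 : ℤ) - Finsupp.single T₀ 1) + (Finsupp.single (oflipCM c hc2 q' T₀) (1 : ℤ) - Finsupp.single T₀ 1)) +
      Finsupp.single T₀ 1) -
      ((pair c (oflipCM c hc2 p T₁) - Finsupp.single (oflipCM c hc2 p T₁) (1 : ℤ)) - (pair c T₁ - Finsupp.single T₁ 1) +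
        (∑ u ∈ (T₀.1 ∩ T₁.1) \ {q, q'}, (pair c (oflipCM c hc2 u T₁) - Finsupp.single (oflipCM c hc2 u T₁) (1 : ℤ)) -
          (2 : ℤ) • (pair c T₁ - Finsupp.single T₁ 1)) + (pair c T₁ - Finsupp.single T₁ 1)) -
      ((Finsupp.single (oflipCM c hc2 p T₀) (1 : ℤ) - Finsupp.single T₀ 1) + (Finsupp.single (oflipCM c hc2 p T₁) (1 : ℤ) - Finsupp.single T₁ 1)) -
      (Finsupp.single (oflipCM c hc2 q T₀) (1 : ℤ) + Finsupp.single (oflipCM c hc2 q' T₀) 1 +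
        ∑ u ∈ (T₀.1 ∩ T₁.1) \ {q, q'}, Finsupp.single (oflipCM c hc2 u T₁) (1 : ℤ) -
        (((2 : ℕ) : ℤ) - 1) • (Finsupp.single T₀ (1 : ℤ) + Finsupp.single T₁ 1)) =
      (2 : ℤ) • pair c T₁ - pair c (oflipCM c hc2 p T₁) -
        (∑ u ∈ (T₀.1 ∩ T₁.1) \ {q, q'}, (pair c (oflipCM c hc2 u T₁) - Finsupp.single (oflipCM c hc2 u T₁) (1 : ℤ)) +
          ∑ u ∈ (T₀.1 ∩ T₁.1) \ {q, q'}, Finsupp.single (oflipCM c hc2 u T₁) (1 : ℤ)) := by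
    push_cast; module
  rw [e, ← sum_add_distrib]
  refine Submodule.sub_mem _ (Submodule.sub_mem _ (Submodule.smul_mem _ _ (hP T₁)) (hP _)) (Submodule.sum_mem _ fun u _ => ?_)
  rw [sub_add_cancel]; exact hP _

/-! ## §2 The `T₀`-defects of the corners of the designated face -/

include hcen hbase hn hH hP hcover in
/-- **The level-2 corner has its `T₀`-defect in `L`** (`m = 2`, given `Rᶜ({q, q'}) ∈ L`): whichever way the cover lowers `⟨q, q'⟩` (part XVII), the
difference of the two star forms is `Rᶜ({q, q'})` modulo pairs. [folklore] -/
theorem defect_pair_corner_mem (hm : m = 2) {q q' : G} (hq : q ∈ T₀.1 ∩ T₁.1) (hq' : q' ∈ T₀.1 ∩ T₁.1) (hqq' : q ≠ q')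
    (Y : CMF G c) (hY : T₀.1 \ Y.1 = {q, q'})
    (hRc : ∑ s ∈ ({q, q'} : Finset G), Finsupp.single (oflipCM c hc2 s T₀) (1 : ℤ) +
        ∑ u ∈ (T₀.1 ∩ T₁.1) \ {q, q'}, Finsupp.single (oflipCM c hc2 u T₁) (1 : ℤ) -
        ((m : ℤ) - 1) • (Finsupp.single T₀ (1 : ℤ) + Finsupp.single T₁ 1) ∈ L) :
    Finsupp.single Y 1 - thetaG c hc2 T₀ (typeSum G c (Finsupp.single Y 1)) ∈ L := by
  rcases pair_corner_dichotomy_shapeA c hc2 hcen T₀ T₁ hbase m hn hH L hcover (by omega) hq hq' hqq' Y hY with h | h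
  · exact h
  · have hd := thetaG_sub_thetaG_compl_pair_mem c hc2 hcen T₀ T₁ m hn hH L hP hm hq hq' hqq' Y hY
    have h' := Submodule.sub_mem _ (Submodule.sub_mem _ h hd) hRc
    have e : Finsupp.single Y 1 - thetaG c hc2 T₀ (typeSum G c (Finsupp.single Y 1)) =
        Finsupp.single Y 1 - thetaG c hc2 (rt c c T₁) (typeSum G c (Finsupp.single Y 1)) -
          (thetaG c hc2 T₀ (typeSum G c (Finsupp.single Y 1)) - thetaG c hc2 (rt c c T₁) (typeSum G c (Finsupp.single Y 1)) -
            (∑ s ∈ ({q, q'} : Finset G), Finsupp.single (oflipCM c hc2 s T₀) (1 : ℤ) +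
              ∑ u ∈ (T₀.1 ∩ T₁.1) \ {q, q'}, Finsupp.single (oflipCM c hc2 u T₁) (1 : ℤ) -
              ((m : ℤ) - 1) • (Finsupp.single T₀ (1 : ℤ) + Finsupp.single T₁ 1))) -
          (∑ s ∈ ({q, q'} : Finset G), Finsupp.single (oflipCM c hc2 s T₀) (1 : ℤ) +
            ∑ u ∈ (T₀.1 ∩ T₁.1) \ {q, q'}, Finsupp.single (oflipCM c hc2 u T₁) (1 : ℤ) -
            ((m : ℤ) - 1) • (Finsupp.single T₀ (1 : ℤ) + Finsupp.single T₁ 1)) := by abel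
    rw [e]; exact h'

include hcen hbase hn hH hQ hP hcover in
/-- **The level-3 corner has its `T₀`-defect in `L` or in `−Y_p + L`** (`m = 2`, given `Rᶜ({q, q'}) ∈ L`): by part XVI the cover gives the star form
toward `T₀` or toward `T̄₁`, and in the second case the defect is `−(Y_p + Rᶜ({q, q'}))` modulo pairs. [folklore] -/
theorem defect_tie_corner_cases (hm : m = 2) {p q q' : G} (hp : p ∈ T₀.1 \ T₁.1) (hq : q ∈ T₀.1 ∩ T₁.1) (hq' : q' ∈ T₀.1 ∩ T₁.1)
    (hqq' : q ≠ q') (X : CMF G c) (hX : T₀.1 \ X.1 = {p, q, q'})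
    (hRc : ∑ s ∈ ({q, q'} : Finset G), Finsupp.single (oflipCM c hc2 s T₀) (1 : ℤ) +
        ∑ u ∈ (T₀.1 ∩ T₁.1) \ {q, q'}, Finsupp.single (oflipCM c hc2 u T₁) (1 : ℤ) -
        ((m : ℤ) - 1) • (Finsupp.single T₀ (1 : ℤ) + Finsupp.single T₁ 1) ∈ L) :
    Finsupp.single X 1 - thetaG c hc2 T₀ (typeSum G c (Finsupp.single X 1)) ∈ L ∨
      Finsupp.single X 1 - thetaG c hc2 T₀ (typeSum G c (Finsupp.single X 1)) +
        ((Finsupp.single (oflipCM c hc2 p T₀) (1 : ℤ) - Finsupp.single T₀ 1) + (Finsupp.single (oflipCM c hc2 p T₁) (1 : ℤ) - Finsupp.single T₁ 1))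
        ∈ L := by
  rcases tie_corner_dichotomy_shapeA c hc2 hcen T₀ T₁ hbase m hn hH Q hQ L hcover hm hp hq hq' hqq' X hX with h | h
  · exact Or.inl h
  · right
    have hd := thetaG_sub_thetaG_compl_tie_mem c hc2 hcen T₀ T₁ m hn hH L hP hm hp hq hq' hqq' X hX
    have h' := Submodule.sub_mem _ (Submodule.sub_mem _ h hd) hRc
    have e : Finsupp.single X 1 - thetaG c hc2 T₀ (typeSum G c (Finsupp.single X 1)) +
        ((Finsupp.single (oflipCM c hc2 p T₀) (1 : ℤ) - Finsupp.single T₀ 1) + (Finsupp.single (oflipCM c hc2 p T₁) (1 : ℤ) - Finsupp.single T₁ 1)) =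
        Finsupp.single X 1 - thetaG c hc2 (rt c c T₁) (typeSum G c (Finsupp.single X 1)) -
          (thetaG c hc2 T₀ (typeSum G c (Finsupp.single X 1)) - thetaG c hc2 (rt c c T₁) (typeSum G c (Finsupp.single X 1)) -
            ((Finsupp.single (oflipCM c hc2 p T₀) (1 : ℤ) - Finsupp.single T₀ 1) +
              (Finsupp.single (oflipCM c hc2 p T₁) (1 : ℤ) - Finsupp.single T₁ 1)) -
            (∑ s ∈ ({q, q'} : Finset G), Finsupp.single (oflipCM c hc2 s T₀) (1 : ℤ) +
              ∑ u ∈ (T₀.1 ∩ T₁.1) \ {q, q'}, Finsupp.single (oflipCM c hc2 u T₁) (1 : ℤ) -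
              ((m : ℤ) - 1) • (Finsupp.single T₀ (1 : ℤ) + Finsupp.single T₁ 1))) -
          (∑ s ∈ ({q, q'} : Finset G), Finsupp.single (oflipCM c hc2 s T₀) (1 : ℤ) +
            ∑ u ∈ (T₀.1 ∩ T₁.1) \ {q, q'}, Finsupp.single (oflipCM c hc2 u T₁) (1 : ℤ) -
            ((m : ℤ) - 1) • (Finsupp.single T₀ (1 : ℤ) + Finsupp.single T₁ 1)) := by abel
    rw [e]; exact h'

/-! ## §3 The swap fixes the designated type and the classes `Y_p` modulo `L` -/

include hc2 hQ hQQ hσH in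
/-- **The designated type is `Q`-stable**: if `D(Φ) = T ∪ {a, a'}` with `T ⊆ 𝓗` a transversal of the place involution and `{a, a'} ⊆ T₀ ∩ T₁` a swapped
pair, then `Φ·Q⁻¹ = Φ`. [folklore] -/
theorem rt_pair_type_eq_self (T : Finset G) (hTH : T ⊆ T₀.1 \ T₁.1)
    (hT : ∀ t ∈ T₀.1 \ T₁.1, ∀ t' ∈ T₀.1, (t' = t * Q ∨ t' = c * (t * Q)) → (t ∈ T ↔ t' ∉ T))
    {a a' : G} (ha : a ∈ T₀.1 ∩ T₁.1) (ha' : a' ∈ T₀.1) (haa' : a' = a * Q ∨ a' = c * (a * Q))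
    (Φ : CMF G c) (hΦ : T₀.1 \ Φ.1 = T ∪ {a, a'}) : rt c Q Φ = Φ := by
  have ha'1 : a' ∈ T₁.1 := by
    by_contra h
    exact (mem_sdiff.mp ((hσH a (mem_inter.mp ha).1 a' ha' haa').mpr (mem_sdiff.mpr ⟨ha', h⟩))).2 (mem_inter.mp ha).2
  have hHdev : T₀.1 \ (rt c Q T₀).1 = T₀.1 \ T₁.1 := by rw [hQ]
  refine rt_eq_self_of_transversal c T₀ Q (T₀.1 \ T₁.1) hHdev hσH Φ T {a, a'} hΦ hTH ?_ hT ?_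
  · intro x hx; rw [mem_insert, mem_singleton] at hx
    rw [sdiff_sdiff_self_left]
    rcases hx with rfl | rfl
    · exact ha
    · exact mem_inter.mpr ⟨ha', ha'1⟩
  · intro t ht t' ht' htt'
    have ht0 : t ∈ T₀.1 := (mem_sdiff.mp ht).1
    have hback : t = t' * Q ∨ t = c * (t' * Q) := rep_rep c hc2 hQQ htt'
    rw [mem_insert, mem_singleton, mem_insert, mem_singleton]
    constructor
    · rintro (rfl | rfl)
      · exact Or.inr (rep_unique' c T₀.2 ht' ha' htt' haa')
      · exact Or.inl (rep_unique' c T₀.2 ht' (mem_inter.mp ha).1 htt' (rep_rep c hc2 hQQ haa'))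
    · rintro (rfl | rfl)
      · exact Or.inr (rep_unique' c T₀.2 ht0 ha' hback haa')
      · exact Or.inl (rep_unique' c T₀.2 ht0 (mem_inter.mp ha).1 hback (rep_rep c hc2 hQQ haa'))

include hQ hQQ in
/-- **`Y_p·Q⁻¹ = Y_{σp}`**: the base change along `Q` carries `(f_p − e₀) + (g_p − e₁)` to `(g_{p'} − e₁) + (f_{p'} − e₀)` for the representative `p'`
of the place of `p·Q`. [folklore] -/
theorem mapDomain_rt_Y {p p' : G} (hpp' : p' = p * Q ∨ p' = c * (p * Q)) :
    Finsupp.mapDomain (rt c Q) ((Finsupp.single (oflipCM c hc2 p T₀) (1 : ℤ) - Finsupp.single T₀ 1) +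
      (Finsupp.single (oflipCM c hc2 p T₁) (1 : ℤ) - Finsupp.single T₁ 1)) =
      (Finsupp.single (oflipCM c hc2 p' T₁) (1 : ℤ) - Finsupp.single T₁ 1) +
      (Finsupp.single (oflipCM c hc2 p' T₀) (1 : ℤ) - Finsupp.single T₀ 1) := by
  have hQ1 : rt c Q T₁ = T₀ := by rw [← hQ, ← rt_mul, hQQ, rt_one]
  have hQinv : Q⁻¹ = Q := inv_eq_of_mul_eq_one_right hQQ
  have hflip : ∀ X : CMF G c, oflipCM c hc2 (p * Q⁻¹) X = oflipCM c hc2 p' X := fun X => by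
    rw [hQinv]
    rcases hpp' with rfl | rfl
    · rfl
    · rw [oflipCM_cmul]
  simp only [Finsupp.mapDomain_add, Finsupp.mapDomain_sub, Finsupp.mapDomain_single, rt_oflipCM, hQ, hQ1, hflip]

include hc2 hcen hbase hn hH hQ hQQ hσH hLrt hcover in
/-- **`Y_p − Y_p·Q⁻¹ ∈ L`** for `p` in a transversal `T ⊆ 𝓗` (`m ≥ 2`): part VIIʼs `Y_p − Y_{σp} ∈ L`. [folklore] -/
theorem Y_sub_mapDomain_rt_Y_mem (hm : 2 ≤ m) (T : Finset G) (hTH : T ⊆ T₀.1 \ T₁.1) (hTm : T.card = m)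
    (hT : ∀ t ∈ T₀.1 \ T₁.1, ∀ t' ∈ T₀.1, (t' = t * Q ∨ t' = c * (t * Q)) → (t ∈ T ↔ t' ∉ T)) {p : G} (hp : p ∈ T) :
    ((Finsupp.single (oflipCM c hc2 p T₀) (1 : ℤ) - Finsupp.single T₀ 1) + (Finsupp.single (oflipCM c hc2 p T₁) (1 : ℤ) - Finsupp.single T₁ 1)) -
      Finsupp.mapDomain (rt c Q) ((Finsupp.single (oflipCM c hc2 p T₀) (1 : ℤ) - Finsupp.single T₀ 1) +
        (Finsupp.single (oflipCM c hc2 p T₁) (1 : ℤ) - Finsupp.single T₁ 1)) ∈ L := by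
  obtain ⟨p', hp'0, hpp'⟩ := exists_rep c T₀.2 (p * Q)
  rw [mapDomain_rt_Y c hc2 T₀ T₁ Q hQ hQQ hpp']
  have h := Y_sub_Y_mem c hc2 hcen T₀ T₁ hbase m hn hH Q hQ hQQ hσH L hLrt hcover hm T hTH hTm hT hp hp'0 hpp'
  have e : ((Finsupp.single (oflipCM c hc2 p T₀) (1 : ℤ) - Finsupp.single T₀ 1) + (Finsupp.single (oflipCM c hc2 p T₁) (1 : ℤ) - Finsupp.single T₁ 1)) -
      ((Finsupp.single (oflipCM c hc2 p' T₁) (1 : ℤ) - Finsupp.single T₁ 1) + (Finsupp.single (oflipCM c hc2 p' T₀) (1 : ℤ) - Finsupp.single T₀ 1)) =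
      (Finsupp.single (oflipCM c hc2 p T₀) (1 : ℤ) + Finsupp.single (oflipCM c hc2 p T₁) 1) -
        (Finsupp.single (oflipCM c hc2 p' T₀) (1 : ℤ) + Finsupp.single (oflipCM c hc2 p' T₁) 1) := by abel
  rw [e]; exact h

end Frame

end

end Summit.HodgeConjecture.CorCM.Census.CentralSquares
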